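import Summits.CriticalPhenomena.PercolationContinuityZ3.Theorems.Transplant.AutCocompactAnyStabilizers
import Literature.GroupTheory.Nilpotent.TorsionNilpotent
import Literature.GroupTheory.Nilpotent.LowerCentralFactorsFinitelyGenerated
import HarnessLib

/-!
# Φ2 for EVERY cocompact action of a FINITELY GENERATED VIRTUALLY NILPOTENT group — clause (ii) of the lane's C2 words with the stabiliser
# hypothesis removed entirely (kernel, torsion and stabilisers arbitrary; finite generation the only residue)

builds on p205010 (kernel theorem, internal audit signed; external expert review pending).  Lane `prim-bschramm`, seat `prim-bschramm-stmt`
gen 38 (stmt port pen).  Helper file (`--supports stmt-CriticalPhenomena-4575 --as helper`); PROOFS ONLY (def-free, no `instance`, no notation);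
NOT by-name — no `@[conjecture]` node is touched or settled, STATEMENTS §5 counts unchanged; nothing about growth beyond what
«AutProperVirtuallyNilpotent» p563737 already carries; nothing about `BenjaminiSchramm1996_conj4_endState`; general quasi-transitive graphs of
polynomial growth stay modulo `Trofimov1985_polynomialGrowthBlocks` («AutCylinderInduction» §4) — this file needs the virtually nilpotent group GIVEN,
acting with finitely many orbits; no 'closed' wording — the words are the lead's.

THE THEOREM (§3, `conj4_of_fg_virtuallyNilpotent_cocompact`; nilpotent spelling `conj4_of_fg_nilpotent_cocompact`; and §4, the HYPOTHESIS-MINIMAL form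
`conj4_of_virtuallyNilpotent_cocompact` with the finite-generation binder discharged — located item L-p5g31-1, lead RULING #7752).  `A` finitely generated with a finite-index nilpotent subgroup `N`, acting by automorphisms
on a connected locally finite graph `X` with finitely many orbits — NOTHING assumed about the kernel, the torsion or the vertex stabilisers of the action
— and `p_c(X) < 1` ⟹ `θ_x(p_c) = 0` at every vertex.  (The lane's «AutProperVirtuallyNilpotent» p563737 needed FINITE stabilisers of the
representatives; «AutCocompactAnyStabilizers» removed that for virtually ABELIAN groups and «AutCocompactTorsionFreeNilpotent» for FAITHFUL
torsion-free nilpotent actions; this file removes it for all finitely generated virtually nilpotent groups.)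

THE MECHANISM (`isOfFinOrder_of_smul_eq_of_torsion_finite`, §1): let a NILPOTENT group act FAITHFULLY (trivial kernel of `A → Perm W`) by
automorphisms with finitely many orbits on a connected locally finite graph, and suppose the SET of its finite-order elements is FINITE.  Then every
element `s` fixing a vertex `w` has finite order.  Induction on the upper central series, claim for `s ∈ Z_{n+1}` fixing `w`: for each `g`, by the
commensurability lemma (`exists_pos_pow_smul_eq` of «AutCocompactAnyStabilizers» §1 — where 'connected' and 'locally finite' enter) some `z = s ^ k`,
`k ≥ 1`, fixes `g • w`; every commutator `⁅z ^ j, g⁆` (`j ∈ ℕ`) lies in `Z_n` and fixes `g • w`, hence has finite order by induction, hence lies in the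
FINITE torsion set — PIGEONHOLE gives `i < j` with `⁅z ^ i, g⁆ = ⁅z ^ j, g⁆`, i.e. (`MulAut.conj` is a homomorphism, injective values) `g` commutes
with `z ^ (j - i)`.  With the finite section set `S` (`exists_finset_closure_smul_reps`: `closure S • reps = W`) a uniform power `s ^ K` is
centralised by `closure S`, a further power fixes every representative, hence every vertex, hence is `1` (faithful): `s` has finite order.  For a
FINITELY GENERATED nilpotent group the torsion elements form a FINITE (normal) subgroup — the tree's Literature reproductions of Baer's theorems
(Clement–Majewicz–Zyman Thms 2.18 / 2.25 / 2.26: `fg_subgroup_of_fg_of_isNilpotent`, `finite_of_fg_of_isTorsion`, `exists_subgroup_coe_eq_isOfFinOrder`)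
— so (§2, `finite_stabilizer_range`) in the IMAGE group `A₀ = A / ker = (MulAction.toPermHom A W).range ≤ Perm W` (faithful by construction,
`eq_one_of_smul_eq_range`; by automorphisms, `isActionByAut_range`; same orbits, `cover_range` — the passage of «AutCocompactAnyStabilizers» §2, here as
three named lemmas) the image `N₀` of the finite-index nilpotent subgroup (finite index by `Subgroup.index_map_dvd`, nilpotent as a surjective image,
finitely generated by `Group.fg_of_surjective` + Schreier `Subgroup.fg_of_index_ne_zero`, finitely many orbits by gen-1 g6's `exists_reps_of_finiteIndex`)
has FINITE torsion subgroup, §1 puts `Stab_{A₀}(w) ∩ N₀` inside it, and `Stab_{A₀}(w)` is finite by `Subgroup.finite_iff_finite_and_finiteIndex`; then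
(§3) gen-5 g3's `conj4_of_virtuallyNilpotent_of_stabilizers_finite` (p563737) applies to `A₀`, `N₀` LITERALLY.  `p_c < 1` stays a HYPOTHESIS here;
its Conjecture-1-shaped characterisation for the same class is the sequel «AutCocompactFinitelyGeneratedDichotomy».  RELATION TO F1 / F2: F1
(virtually ABELIAN) carries NO finite-generation hypothesis and F2 states FREENESS for faithful torsion-free nilpotent actions — neither is superseded
as a statement; this file is the general C2 ACTION form.  The virtually nilpotent group is GIVEN: general quasi-transitive graphs of polynomial growth
stay modulo `Trofimov1985_polynomialGrowthBlocks`; 'polynomial growth ⟺ virtually nilpotent' (Gromov) is cited background, not typed, not used.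
[cite: BenjaminiSchramm1996, §2 (almost transitive graphs), Conj. 4] [cite: ClementMajewiczZyman2017, Thms 2.18, 2.25, 2.26 (Baer; Baer–Hirsch)]
[cite: Woess2000, Prop. 3.9, Lemma 3.13] [cite: LyonsPeres2016, §7.4 (quasi-transitive actions)] [cite: Trofimov1985, Thm. 2 (background only, not used)]
-/

noncomputable section

namespace Summit.CriticalPhenomena.PercolationContinuityZ3.Theorems.Transplant

namespace AutCyl

open SimpleGraph Literature.Barriers.CriticalPhenomena Literature.Probability.LatticeModels Literature.Probability.Percolation
open scoped Classical commutatorElement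

variable {W : Type} {X : SimpleGraph W} {A : Type} [Group A] [MulAction A W] [X.LocallyFinite]

/-! ## §1 Nilpotent, faithful, finitely many orbits, finite torsion set ⟹ every stabiliser element has finite order -/

/-- **THE MECHANISM.**  A NILPOTENT group acting FAITHFULLY (trivial kernel of `A → Perm W`: `(∀ v, a • v = v) → a = 1`) by automorphisms with finitely
many orbits on a connected locally finite graph, whose finite-order elements form a FINITE set: every element fixing a vertex has finite order.
Induction on the upper central series; the step = commensurability (`exists_pos_pow_smul_eq`) + pigeonhole on the commutators `⁅(s ^ k) ^ j, g⁆` in the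
finite torsion set + the finite section set (`exists_finset_closure_smul_reps`) + faithfulness; no finite-generation hypothesis here.
[folklore] [cite: Woess2000, Prop. 3.9, Lemma 3.13] -/
theorem isOfFinOrder_of_smul_eq_of_torsion_finite [Group.IsNilpotent A] (htfin : {a : A | IsOfFinOrder a}.Finite)
    (hfaith : ∀ a : A, (∀ v : W, a • v = v) → a = 1) (hact : IsActionByAut X A) (hc : X.Connected) (reps : Finset W)
    (hcover : ∀ w : W, ∃ a : A, ∃ r ∈ reps, a • r = w) {s : A} {w : W} (hsw : s • w = w) : IsOfFinOrder s := by
  obtain ⟨S, hS⟩ := exists_finset_closure_smul_reps hact hc reps hcover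
  have key : ∀ (n : ℕ) (w : W) (s : A), s • w = w → s ∈ Subgroup.upperCentralSeries A n → IsOfFinOrder s := by
    intro n
    induction n with
    | zero =>
      intro w s _ hs
      rw [Subgroup.upperCentralSeries_zero, Subgroup.mem_bot] at hs
      rw [hs]
      exact IsOfFinOrder.one
    | succ n ih =>
      intro w s hsw hs
      -- Step 1: every `g` commutes with some positive power of `s`
      have hcommute : ∀ g : A, ∃ k : ℕ, 0 < k ∧ Commute g (s ^ k) := fun g => by
        obtain ⟨k, hk, hfix⟩ := exists_pos_pow_smul_eq hact hc hsw (g • w)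
        have hu : ∀ j : ℕ, ⁅(s ^ k) ^ j, g⁆ ∈ {a : A | IsOfFinOrder a} := fun j => by
          have hZ : ⁅(s ^ k) ^ j, g⁆ ∈ Subgroup.upperCentralSeries A n :=
            (Subgroup.mem_upperCentralSeries_succ_iff.1 (Subgroup.pow_mem _ (Subgroup.pow_mem _ hs k) j)) g
          have hfixj : (s ^ k) ^ j • (g • w) = g • w := pow_smul_eq_of_smul_eq hfix j
          have hinvw : ((s ^ k) ^ j)⁻¹ • w = w := inv_smul_eq_iff.2 (pow_smul_eq_of_smul_eq (pow_smul_eq_of_smul_eq hsw k) j).symm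
          have hufix : ⁅(s ^ k) ^ j, g⁆ • (g • w) = g • w := by
            rw [commutatorElement_def, mul_smul, mul_smul, mul_smul, inv_smul_smul, hinvw, hfixj]
          exact ih (g • w) _ hufix hZ
        obtain ⟨i, j, hij, he⟩ := htfin.exists_lt_map_eq_of_forall_mem hu
        have hsplit : (s ^ k) ^ j = (s ^ k) ^ i * (s ^ k) ^ (j - i) := by rw [← pow_add, Nat.add_sub_cancel' hij.le]
        have h1 : MulAut.conj ((s ^ k) ^ i) g = MulAut.conj ((s ^ k) ^ j) g := by
          rw [MulAut.conj_apply, MulAut.conj_apply]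
          rw [commutatorElement_def, commutatorElement_def] at he
          exact mul_right_cancel he
        rw [hsplit, map_mul, MulAut.mul_apply] at h1
        have h2 : g = (s ^ k) ^ (j - i) * g * ((s ^ k) ^ (j - i))⁻¹ := by
          have h3 := (MulEquiv.injective (MulAut.conj ((s ^ k) ^ i))) h1
          rwa [MulAut.conj_apply] at h3
        refine ⟨k * (j - i), Nat.mul_pos hk (Nat.sub_pos_of_lt hij), ?_⟩
        rw [pow_mul]
        calc g * (s ^ k) ^ (j - i) = (s ^ k) ^ (j - i) * g * ((s ^ k) ^ (j - i))⁻¹ * (s ^ k) ^ (j - i) := by rw [← h2]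
          _ = (s ^ k) ^ (j - i) * g := by rw [inv_mul_cancel_right]
      choose k hk hkc using hcommute
      -- Step 2: a uniform power central on `closure S`
      set K : ℕ := ∏ g ∈ S, k g with hK
      have hKpos : 0 < K := Finset.prod_pos fun g _ => hk g
      have hcen : Subgroup.closure (S : Set A) ≤ Subgroup.centralizer {s ^ K} := by
        rw [Subgroup.closure_le]
        intro g hgS
        rw [SetLike.mem_coe, Subgroup.mem_centralizer_iff]
        intro h hh
        rw [Set.mem_singleton_iff] at hh
        subst hh
        obtain ⟨m, hm⟩ := Finset.dvd_prod_of_mem k (Finset.mem_coe.1 hgS)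
        rw [hK, hm, pow_mul]
        exact ((hkc g).pow_right m).symm.eq
      -- Step 3: a further power fixing every representative, hence every vertex
      have hsKw : (s ^ K) • w = w := pow_smul_eq_of_smul_eq hsw K
      have hfixr : ∀ r : W, ∃ m : ℕ, 0 < m ∧ (s ^ K) ^ m • r = r := fun r => exists_pos_pow_smul_eq hact hc hsKw r
      choose m hm hmfix using hfixr
      set M : ℕ := ∏ r ∈ reps, m r with hM
      have hMpos : 0 < M := Finset.prod_pos fun r _ => hm r
      have hfixall : ∀ v : W, (s ^ K) ^ M • v = v := fun v => by
        obtain ⟨a, ha, r, hr, rfl⟩ := hS v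
        obtain ⟨q, hq⟩ := Finset.dvd_prod_of_mem m hr
        have hc1 : Commute (s ^ K) a := Subgroup.mem_centralizer_iff.1 (hcen ha) (s ^ K) (Set.mem_singleton _)
        calc (s ^ K) ^ M • a • r = ((s ^ K) ^ M * a) • r := by rw [mul_smul]
          _ = (a * (s ^ K) ^ M) • r := by rw [(hc1.pow_left M).eq]
          _ = a • ((s ^ K) ^ M • r) := by rw [mul_smul]
          _ = a • r := by rw [hM, hq, pow_mul, pow_smul_eq_of_smul_eq (hmfix r) q]
      -- Step 4: faithful ⟹ `s ^ (K M) = 1`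
      have hone : (s ^ K) ^ M = 1 := hfaith _ hfixall
      exact isOfFinOrder_iff_pow_eq_one.2 ⟨K * M, Nat.mul_pos hKpos hMpos, by rw [pow_mul, hone]⟩
  obtain ⟨n, hn⟩ := Group.IsNilpotent.nilpotent A
  refine key n w s hsw ?_
  rw [hn]
  exact Subgroup.mem_top s

/-! ## §2 The image group `A₀ = A / ker ≤ Perm W` and its finite-index nilpotent subgroup -/

section Range

omit [X.LocallyFinite] in
/-- The image group `(MulAction.toPermHom A W).range ≤ Perm W` acts (through Mathlib's `Perm` action, `σ • v = σ v`) by automorphisms if `A` does.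
[folklore] -/
theorem isActionByAut_range (hact : IsActionByAut X A) : IsActionByAut X (MulAction.toPermHom A W).range := fun σ u v => by
  obtain ⟨a, ha⟩ := MonoidHom.mem_range.1 σ.2
  show X.Adj ((σ : Equiv.Perm W) u) ((σ : Equiv.Perm W) v) ↔ X.Adj u v
  rw [← ha]
  exact hact a u v

omit [X.LocallyFinite] in
/-- `reps` meets every orbit of the image group if it meets every `A`-orbit. [folklore] -/
theorem cover_range {reps : Finset W} (hcover : ∀ w : W, ∃ a : A, ∃ r ∈ reps, a • r = w) :
    ∀ w : W, ∃ σ : (MulAction.toPermHom A W).range, ∃ r ∈ reps, σ • r = w := fun w => by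
  obtain ⟨a, r, hr, hw⟩ := hcover w
  exact ⟨⟨MulAction.toPermHom A W a, MonoidHom.mem_range.2 ⟨a, rfl⟩⟩, r, hr, hw⟩

omit [X.LocallyFinite] in
/-- The image group acts FAITHFULLY: an element fixing every vertex is `1`. [folklore] -/
theorem eq_one_of_smul_eq_range (σ : (MulAction.toPermHom A W).range) (h : ∀ v : W, σ • v = v) : σ = 1 :=
  Subtype.ext (Equiv.ext fun v => h v)

/-- **EVERY STABILISER OF THE IMAGE GROUP IS FINITE** when `A` is FINITELY GENERATED and VIRTUALLY NILPOTENT (finite-index nilpotent `N`) and acts by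
automorphisms with finitely many orbits on a connected locally finite graph — nothing assumed about the action's kernel, torsion or stabilisers.
ROUTE: `A₀ := (toPermHom A W).range`, `N₀ := N.map (rangeRestrict)` — finite index (`Subgroup.index_map_dvd`), nilpotent (`Group.nilpotent_of_surjective`
on `MonoidHom.subgroupMap`), finitely generated (Schreier, `Subgroup.fg_of_index_ne_zero`, from `Group.fg_of_surjective`); the torsion elements of `N₀`
form a subgroup (`Literature.GroupTheory.Nilpotent.exists_subgroup_coe_eq_isOfFinOrder`, CMZ Thm 2.26), finitely generated
(`Literature.GroupTheory.Nilpotent.fg_subgroup_of_fg_of_isNilpotent`, Thm 2.18), hence FINITE (`Literature.GroupTheory.Nilpotent.finite_of_fg_of_isTorsion`,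
Thm 2.25 — Baer); `N₀` acts faithfully with finitely many orbits (`exists_reps_of_finiteIndex`), so §1 puts `Stab_{A₀}(w) ∩ N₀` inside that finite torsion
subgroup, and `[Stab_{A₀}(w) : Stab_{A₀}(w) ∩ N₀] ≤ [A₀ : N₀] < ∞` (`Subgroup.finite_iff_finite_and_finiteIndex`).
[cite: ClementMajewiczZyman2017, Thms 2.18, 2.25, 2.26] [cite: BenjaminiSchramm1996, §2 (almost transitive graphs)] -/
theorem finite_stabilizer_range [Group.FG A] (N : Subgroup A) [N.FiniteIndex] [Group.IsNilpotent N] (hc : X.Connected)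
    (hact : IsActionByAut X A) (reps : Finset W) (hcover : ∀ w : W, ∃ a : A, ∃ r ∈ reps, a • r = w) (w : W) :
    (MulAction.stabilizer (MulAction.toPermHom A W).range w : Set (MulAction.toPermHom A W).range).Finite := by
  set ι : A →* Equiv.Perm W := MulAction.toPermHom A W with hι
  set e : A →* ι.range := ι.rangeRestrict with hedef
  have he : Function.Surjective e := ι.rangeRestrict_surjective
  set N₀ : Subgroup ι.range := N.map e with hN₀
  haveI hN₀fi : N₀.FiniteIndex := ⟨fun h0 =>
    Subgroup.FiniteIndex.index_ne_zero (Nat.eq_zero_of_zero_dvd (h0 ▸ Subgroup.index_map_dvd (H := N) he))⟩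
  haveI : Group.IsNilpotent N₀ := Group.nilpotent_of_surjective (e.subgroupMap N) (e.subgroupMap_surjective N)
  haveI : Group.FG ι.range := Group.fg_of_surjective he
  haveI : Group.FG N₀ := Subgroup.fg_of_index_ne_zero N₀
  -- the torsion subgroup of the finitely generated nilpotent `N₀` is finite (Baer)
  obtain ⟨T, -, hT⟩ := Literature.GroupTheory.Nilpotent.exists_subgroup_coe_eq_isOfFinOrder (G := N₀)
  haveI : Group.FG T := Literature.GroupTheory.Nilpotent.fg_subgroup_of_fg_of_isNilpotent T
  have hTtors : Monoid.IsTorsion T := fun t => by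
    have ht : (t : N₀) ∈ (T : Set N₀) := t.2
    rw [hT] at ht
    exact Submonoid.isOfFinOrder_coe.1 ht
  haveI : Finite T := Literature.GroupTheory.Nilpotent.finite_of_fg_of_isTorsion hTtors
  have htfin : {n : N₀ | IsOfFinOrder n}.Finite := by
    rw [← hT]
    exact Set.toFinite _
  -- `N₀` acts faithfully, by automorphisms, with finitely many orbits
  have hact₀ : IsActionByAut X ι.range := isActionByAut_range hact
  obtain ⟨reps₀, hcover₀⟩ := exists_reps_of_finiteIndex N₀ reps (cover_range hcover)
  have hfaithN : ∀ n : N₀, (∀ v : W, n • v = v) → n = 1 := fun n h =>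
    Subtype.ext (eq_one_of_smul_eq_range (n : ι.range) fun v => h v)
  -- `Stab(w) ∩ N₀` injects into the finite torsion subgroup `T`
  set S : Subgroup ι.range := MulAction.stabilizer ι.range w with hS
  have hmemT : ∀ x : N₀.subgroupOf S, (⟨((x : S) : ι.range), Subgroup.mem_subgroupOf.1 x.2⟩ : N₀) ∈ T := fun x => by
    rw [← SetLike.mem_coe, hT]
    refine isOfFinOrder_of_smul_eq_of_torsion_finite htfin hfaithN (isActionByAut_subgroup hact₀ N₀) hc reps₀ hcover₀
      (w := w) ?_
    exact MulAction.mem_stabilizer_iff.1 (x : S).2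
  let f : N₀.subgroupOf S → T := fun x => ⟨_, hmemT x⟩
  have hf : Function.Injective f := fun x y hxy =>
    Subtype.ext (Subtype.ext (congrArg (fun t : T => ((t : N₀) : ι.range)) hxy))
  haveI : Finite (N₀.subgroupOf S) := Finite.of_injective f hf
  haveI : Finite S := (Subgroup.finite_iff_finite_and_finiteIndex (H := N₀.subgroupOf S)).2 ⟨inferInstance, inferInstance⟩
  exact Set.toFinite _

end Range

/-! ## §3 Φ2 for every cocompact action of a finitely generated virtually nilpotent group -/

/-- **Φ2 / CONJECTURE 4 FOR EVERY COCOMPACT ACTION OF A FINITELY GENERATED VIRTUALLY NILPOTENT GROUP — the stabiliser hypothesis of the C2 clause (ii)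
REMOVED.**  `A` finitely generated with a finite-index nilpotent subgroup `N`, acting by automorphisms with finitely many orbits on a connected locally
finite graph — kernel, torsion and stabilisers arbitrary — and `p_c(X) < 1` ⟹ `θ_x(p_c) = 0` at every vertex `x`: gen-5 g3's
`conj4_of_virtuallyNilpotent_of_stabilizers_finite` (p563737) applied LITERALLY to the image group `A₀` with `N₀ = N.map _` and the finite stabilisers
of §2; `p_c < 1` a HYPOTHESIS (characterised in the sequel «AutCocompactFinitelyGeneratedDichotomy»).
[cite: BenjaminiSchramm1996, Conj. 4; §2 (almost transitive graphs)] [cite: LyonsPeres2016, §7.4 (quasi-transitive actions)]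
[cite: ClementMajewiczZyman2017, Thms 2.18, 2.25, 2.26] -/
theorem conj4_of_fg_virtuallyNilpotent_cocompact [Group.FG A] (hc : X.Connected) (hact : IsActionByAut X A) (reps : Finset W)
    (hcover : ∀ w : W, ∃ a : A, ∃ r ∈ reps, a • r = w) (N : Subgroup A) [N.FiniteIndex] [Group.IsNilpotent N]
    (x : W) (hpc : criticalProb X x < 1) : theta X x (criticalProbIOf X x) = 0 := by
  set ι : A →* Equiv.Perm W := MulAction.toPermHom A W with hι
  have he : Function.Surjective ι.rangeRestrict := ι.rangeRestrict_surjective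
  haveI : (N.map ι.rangeRestrict).FiniteIndex := ⟨fun h0 =>
    Subgroup.FiniteIndex.index_ne_zero (Nat.eq_zero_of_zero_dvd (h0 ▸ Subgroup.index_map_dvd (H := N) he))⟩
  haveI : Group.IsNilpotent (N.map ι.rangeRestrict) :=
    Group.nilpotent_of_surjective (ι.rangeRestrict.subgroupMap N) (ι.rangeRestrict.subgroupMap_surjective N)
  exact conj4_of_virtuallyNilpotent_of_stabilizers_finite hc (isActionByAut_range hact) reps (cover_range hcover)
    (fun r _ => finite_stabilizer_range N hc hact reps hcover r) (N.map ι.rangeRestrict) x hpc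

/-- **The nilpotent spelling**: `A` finitely generated NILPOTENT, any action by automorphisms with finitely many orbits on a connected locally finite graph
with `p_c < 1` ⟹ `θ_x(p_c) = 0` (`N = ⊤`). [cite: BenjaminiSchramm1996, Conj. 4; §2 (almost transitive graphs)] -/
theorem conj4_of_fg_nilpotent_cocompact [Group.IsNilpotent A] [Group.FG A] (hc : X.Connected) (hact : IsActionByAut X A)
    (reps : Finset W) (hcover : ∀ w : W, ∃ a : A, ∃ r ∈ reps, a • r = w) (x : W) (hpc : criticalProb X x < 1) :
    theta X x (criticalProbIOf X x) = 0 :=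
  conj4_of_fg_virtuallyNilpotent_cocompact hc hact reps hcover (⊤ : Subgroup A) x hpc

/-! ## §4 Finite generation is idle: every VIRTUALLY NILPOTENT group (located item L-p5g31-1, lead RULING #7752) -/

/-- **Φ2 / CONJECTURE 4 FOR EVERY COCOMPACT ACTION OF A VIRTUALLY NILPOTENT GROUP — NOTHING ELSE ASSUMED** (finite generation, stabilisers, kernel,
torsion all arbitrary): `A` with a finite-index nilpotent subgroup `N`, acting by automorphisms with finitely many orbits on a connected locally finite
graph with `p_c < 1` ⟹ `θ_x(p_c) = 0` at every vertex.  The binder `[Group.FG A]` of §3 is IDLE (refuter p5-g31, L-p5g31-1): by F1's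
`exists_finset_closure_smul_reps` the action restricts to the FINITELY GENERATED subgroup `H = closure S` with the same representatives
(`Group.closure_finset_fg`), `N.subgroupOf H` has finite index (`Subgroup.instFiniteIndex_subgroupOf`) and is nilpotent (it is `H ⊓ N` seen inside the
nilpotent `N`, transported by the tautological `MulEquiv`), and the conclusion does not mention the group.  'Virtually nilpotent' stays load-bearing;
`p_c < 1` stays a hypothesis. [cite: BenjaminiSchramm1996, Conj. 4; §2 (almost transitive graphs)] [cite: Woess2000, Prop. 3.9 (cocompact actions restrict to finitely generated subgroups)] -/
theorem conj4_of_virtuallyNilpotent_cocompact (hc : X.Connected) (hact : IsActionByAut X A) (reps : Finset W)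
    (hcover : ∀ w : W, ∃ a : A, ∃ r ∈ reps, a • r = w) (N : Subgroup A) [N.FiniteIndex] [Group.IsNilpotent N]
    (x : W) (hpc : criticalProb X x < 1) : theta X x (criticalProbIOf X x) = 0 := by
  obtain ⟨S, hS⟩ := exists_finset_closure_smul_reps hact hc reps hcover
  set H : Subgroup A := Subgroup.closure (S : Set A) with hH
  have hcoverH : ∀ w : W, ∃ a : H, ∃ r ∈ reps, a • r = w := fun w => by
    obtain ⟨a, ha, r, hr, hw⟩ := hS w
    exact ⟨⟨a, ha⟩, r, hr, hw⟩
  -- `N ⊓ H` inside `H` is nilpotent: it is `H ⊓ N` inside the nilpotent `N`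
  let e : H.subgroupOf N ≃* N.subgroupOf H :=
    { toFun := fun y => ⟨⟨((y : N) : A), Subgroup.mem_subgroupOf.1 y.2⟩, Subgroup.mem_subgroupOf.2 (y : N).2⟩
      invFun := fun z => ⟨⟨((z : H) : A), Subgroup.mem_subgroupOf.1 z.2⟩, Subgroup.mem_subgroupOf.2 (z : H).2⟩
      left_inv := fun y => rfl
      right_inv := fun z => rfl
      map_mul' := fun y z => rfl }
  haveI : Group.IsNilpotent (N.subgroupOf H) := Group.nilpotent_of_mulEquiv e
  exact conj4_of_fg_virtuallyNilpotent_cocompact (A := H) hc (isActionByAut_subgroup hact H) reps hcoverH (N.subgroupOf H) x hpc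

end AutCyl

end Summit.CriticalPhenomena.PercolationContinuityZ3.Theorems.Transplant

end
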